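import Literature.Computability.AlgebraicComplexity.AlmanLi2026IteratedCWPower
import Literature.Computability.AlgebraicComplexity.AlmanLi2026CWGammaBound
import Literature.Computability.AlgebraicComplexity.AlmanLi2026IteratedCW
import Literature.Computability.AlgebraicComplexity.AlmanLi2026CwTwoBound
import Literature.Computability.AlgebraicComplexity.CoppersmithWinograd1990Proofs
import Literature.Computability.AlgebraicComplexity.TensorRestrictionRank
import HarnessLib

/-!
# Discharge of `AlmanLi2026_iteratedSpeedup_cw` (Alman–Li 2026, §7.1: Thm. 6.2 ∘ Prop. 7.1)

Topic `Literature/Computability/AlgebraicComplexity` (family `MatrixMultiplication`). Source: J. Alman,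
B. Li, *Asymptotic Rank Speedup Theorems, Revisited*, arXiv:2605.21738 (2026), §7.1, the display after
Cor. 7.1 (held text `paper:arxiv-2605.21738`, p0017 L100–107):
`cw_q^{⊗2n} ⊕ 2⊙cw_q^{⊗n} ⊗ ⟨1,t,1⟩ ⊕ ⟨1, t² + 2(q+1)^{2n}, 1⟩ ⊴ (⟨(q+2)^n⟩ ⊕ ⟨1,q^n,1⟩)^{⊗2}`,
`t = (q+2)^n − 2(q+1)^n + q^n`.

This file PROVES the tree's named fact `AlmanLi2026_iteratedSpeedup_cw` (`AlmanLi2026IteratedCW.lean`,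
stated over `ℂ` in the three slice directions `⟨1,·,1⟩, ⟨1,1,·⟩, ⟨·,1,1⟩`):
`AlmanLi2026_iteratedSpeedup_cw_holds`. The mathematics is `AlmanLi2026.thm62_cw`
(`AlmanLi2026IteratedCWPower.lean`, any field); here only relabelling restrictions are composed:
the corner-deleted square is `cw^{⊠n}⊠cw^{⊠n} ⊕ (cw^{⊠n}⊠⟨1,t,1⟩ ⊕ ⟨1,t,1⟩⊠cw^{⊠n})`
(`squareMinusCorner_eq_directSum`), `cw^{⊠n} ⊠ cw^{⊠n} ≥ cw^{⊠2n}` (`kroneckerPow_add_eq_precomp`),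
`X ⊕ X ≥ ⟨2⟩ ⊠ X`, `Y ⊠ X ≥ X ⊠ Y`, re-association of `⊕`, the one-slice tensors versus
`⟨m,1,1⟩ / ⟨1,1,m⟩ / ⟨1,m,1⟩` (`AlmanLi2026CWGammaBound`, `AlmanLi2026BelowBorderRank`), and the cyclic
rotation of the modes for the other two directions (`algDegeneratesTo_rotate_modes`; `cw_q` and `⟨r⟩`
are rotation invariant). No new definitions, no named facts; net debt −2: with the display proved,
the tree's fact `AlmanLi2026_asymptoticRank_cwTwo_lt` (Thm. 1.3, `R̃(cw_2) < 3.931`) follows from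
`AlmanLi2026.asymptoticRank_cwTwo_lt_of_iterated` (`AlmanLi2026CwTwoBound.lean`: the certificate
route of §7.1 / Table 1) — `AlmanLi2026_asymptoticRank_cwTwo_lt_holds` below.

## References

* J. Alman, B. Li, *Asymptotic Rank Speedup Theorems, Revisited*, arXiv:2605.21738 (2026), §7.1
  (held text p0017 L100–107), Thm. 6.2 (p0015 L57–97). [AlmanLi2026]
* M. Bläser, *Fast Matrix Multiplication*, ToC Graduate Surveys 5 (2013), Lemma 5.5 / Def. 7.2
  (permuting modes; relabelling restrictions). [Blaser2013]
-/

noncomputable section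

open scoped BigOperators

namespace Literature.Computability.AlgebraicComplexity

namespace AlmanLi2026

universe u

section Plumbing

variable {K : Type u} [CommSemiring K] {ι κ μ ι' κ' μ' ι'' κ'' μ'' α β ν : Type*}

/-- `rotate (s ⊕ t) = rotate s ⊕ rotate t`. [folklore] -/
private theorem rotate_directSum₂ (s : ι → κ → μ → K) (t : ι' → κ' → μ' → K) :
    rotate (directSumTensor s t) = directSumTensor (rotate s) (rotate t) := by
  funext b c a
  rcases a with a | a <;> rcases b with b | b <;> rcases c with c | c <;> rfl

/-- `rotate (s ⊠ t) = rotate s ⊠ rotate t`. [folklore] -/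
private theorem rotate_kronecker₂ (s : ι → κ → μ → K) (t : ι' → κ' → μ' → K) :
    rotate (kroneckerTensor s t) = kroneckerTensor (rotate s) (rotate t) := by
  funext b c a
  simp [rotate_apply, kroneckerTensor_apply]

/-- `rotate ⟨n⟩ = ⟨n⟩`. [folklore] -/
private theorem rotate_unit₂ (n : ℕ) : rotate (unitTensor K n) = unitTensor K n := by
  funext b c a
  simp only [rotate_apply, unitTensor_apply]
  exact if_congr ⟨fun ⟨h1, h2⟩ => ⟨h2, (h1.trans h2).symm⟩, fun ⟨h1, h2⟩ => ⟨(h1.trans h2).symm, h1⟩⟩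
    rfl rfl

/-- `rotate (t^{⊠N}) = (rotate t)^{⊠N}`. [folklore] -/
private theorem rotate_kroneckerPow₂ (t : ι → κ → μ → K) (N : ℕ) :
    rotate (kroneckerPow t N) = kroneckerPow (rotate t) N := by
  funext b c a
  simp [rotate_apply, kroneckerPow_apply]

omit [CommSemiring K] in
/-- `rotate³ = id`. [folklore] -/
private theorem rotate_rotate_rotate₂ (t : ι → κ → μ → K) : rotate (rotate (rotate t)) = t := rfl

/-- **The corner-deleted square is `T⊠T ⊕ (T⊠T' ⊕ T'⊠T)`** (same index types, equal as functions).
[cite: AlmanLi2026, Thm. 6.2 (statement: `T^{⊗2} ⊕ 2⊙T⊗⟨1,t,1⟩`)] -/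
theorem squareMinusCorner_eq_directSum (T : ι' → κ' → μ' → K) (T' : α → β → ν → K) :
    squareMinusCorner T T' = directSumTensor (kroneckerTensor T T)
      (directSumTensor (kroneckerTensor T T') (kroneckerTensor T' T)) := by
  funext x y w
  rcases x with x | x | x <;> rcases y with y | y | y <;> rcases w with w | w | w <;>
    simp [squareMinusCorner, cornerCompl, directSumTensor, kroneckerTensor_apply]

variable [Fintype ι] [Fintype κ] [Fintype μ] [Fintype ι'] [Fintype κ'] [Fintype μ'] [Fintype ι'']
  [Fintype κ''] [Fintype μ''] [DecidableEq ι] [DecidableEq κ] [DecidableEq μ] [DecidableEq ι']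
  [DecidableEq κ'] [DecidableEq μ'] [DecidableEq ι''] [DecidableEq κ''] [DecidableEq μ'']

/-- Re-association `(A ⊕ B) ⊕ D ≥ A ⊕ (B ⊕ D)` (a relabelling). [cite: Blaser2013, Def. 7.2] -/
theorem tensorRestrictsTo_directSum_assoc (A : ι → κ → μ → K) (B : ι' → κ' → μ' → K)
    (D : ι'' → κ'' → μ'' → K) :
    TensorRestrictsTo (directSumTensor (directSumTensor A B) D)
      (directSumTensor A (directSumTensor B D)) := by
  have e : directSumTensor A (directSumTensor B D) = fun x y z =>
      directSumTensor (directSumTensor A B) D ((Equiv.sumAssoc ι ι' ι'').symm x)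
        ((Equiv.sumAssoc κ κ' κ'').symm y) ((Equiv.sumAssoc μ μ' μ'').symm z) := by
    funext x y z
    rcases x with x | x | x <;> rcases y with y | y | y <;> rcases z with z | z | z <;>
      simp [directSumTensor, Equiv.sumAssoc]
  rw [e]
  exact tensorRestrictsTo_precomp _ _ _ _

/-- `X ⊕ X ≥ ⟨2⟩ ⊠ X` (a relabelling `Fin 2 × I ≃ I ⊕ I`). [cite: Blaser2013, Def. 7.2] -/
theorem tensorRestrictsTo_directSum_self_unit_two (X : ι → κ → μ → K) :
    TensorRestrictsTo (directSumTensor X X) (kroneckerTensor (unitTensor K 2) X) := by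
  have e : kroneckerTensor (unitTensor K 2) X = fun x y z =>
      directSumTensor X X (if x.1 = 0 then Sum.inl x.2 else Sum.inr x.2)
        (if y.1 = 0 then Sum.inl y.2 else Sum.inr y.2) (if z.1 = 0 then Sum.inl z.2 else Sum.inr z.2) := by
    funext x y z
    obtain ⟨i, a⟩ := x
    obtain ⟨j, b⟩ := y
    obtain ⟨k, c⟩ := z
    fin_cases i <;> fin_cases j <;> fin_cases k <;>
      simp [kroneckerTensor_apply, unitTensor_apply, directSumTensor]
  rw [e]
  exact tensorRestrictsTo_precomp _ _ _ _

/-- `Y ⊠ X ≥ X ⊠ Y` (swap relabelling). [cite: Blaser2013, Def. 7.2] -/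
theorem tensorRestrictsTo_kronecker_swap (X : ι → κ → μ → K) (Y : ι' → κ' → μ' → K) :
    TensorRestrictsTo (kroneckerTensor Y X) (kroneckerTensor X Y) := by
  have e : kroneckerTensor X Y = fun x y z =>
      kroneckerTensor Y X x.swap y.swap z.swap := by
    funext x y z
    simp [kroneckerTensor_apply, mul_comm]
  rw [e]
  exact tensorRestrictsTo_precomp _ _ _ _

/-- `t^{⊠n} ⊠ t^{⊠n} ≥ t^{⊠2n}` (split the `2n` coordinates). [cite: Blaser2013, Def. 7.2] -/
theorem tensorRestrictsTo_kroneckerPow_two_mul (t : ι → κ → μ → K) (n : ℕ) :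
    TensorRestrictsTo (kroneckerTensor (kroneckerPow t n) (kroneckerPow t n))
      (kroneckerPow t (2 * n)) := by
  rw [two_mul, kroneckerPow_add_eq_precomp t n n]
  exact tensorRestrictsTo_precomp _ _ _ _

end Plumbing

/-! ## Assembly of one direction -/

section Assemble

variable {K : Type} [Field K] {ιu ιp κp μp ιs κs μs ιm κm μm ιt κt μt ιM κM μM ιt' κt' μt'
  ιM' κM' μM' ι₂ κ₂ μ₂ : Type}
  [Fintype ιu] [Fintype ιp] [Fintype κp] [Fintype μp] [Fintype ιs] [Fintype κs] [Fintype μs]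
  [Fintype ιm] [Fintype κm] [Fintype μm] [Fintype ιt] [Fintype κt] [Fintype μt]
  [Fintype ιt'] [Fintype κt'] [Fintype μt']
  [DecidableEq ιu] [DecidableEq ιp] [DecidableEq κp] [DecidableEq μp]
  [DecidableEq ιt] [DecidableEq κt] [DecidableEq μt] [DecidableEq ιt'] [DecidableEq κt']
  [DecidableEq μt']

/-- One direction of the §7.1 display from the engine-coordinate degeneration: replace the slices
by the matching matrix multiplication tensors, the corner-deleted square by
`P₂ ⊕ ⟨2⟩⊠(P⊠M_t)`, using only relabelling restrictions on both sides. [cite: AlmanLi2026, §7.1] -/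
theorem assemble_direction {U : ιu → ιu → ιu → K} {P : ιp → κp → μp → K}
    {SLs : ιs → κs → μs → K} {Ms : ιm → κm → μm → K} {SLt : ιt → κt → μt → K}
    {Mt : ιM → κM → μM → K} {SLt' : ιt' → κt' → μt' → K} {Mt' : ιM' → κM' → μM' → K}
    {P₂ : ι₂ → κ₂ → μ₂ → K}
    (hcore : AlgDegeneratesTo
      (kroneckerTensor (directSumTensor U SLs) (directSumTensor U SLs))
      (directSumTensor (directSumTensor (kroneckerTensor P P)
        (directSumTensor (kroneckerTensor P SLt) (kroneckerTensor SLt P))) SLt'))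
    (hs : TensorRestrictsTo Ms SLs) (hP : TensorRestrictsTo (kroneckerTensor P P) P₂)
    (ht : TensorRestrictsTo SLt Mt) (ht' : TensorRestrictsTo SLt' Mt') :
    AlgDegeneratesTo
      (kroneckerTensor (directSumTensor U Ms) (directSumTensor U Ms))
      (directSumTensor P₂ (directSumTensor
        (kroneckerTensor (unitTensor K 2) (kroneckerTensor P Mt)) Mt')) := by
  classical
  have hsrc : TensorRestrictsTo (kroneckerTensor (directSumTensor U Ms) (directSumTensor U Ms))
      (kroneckerTensor (directSumTensor U SLs) (directSumTensor U SLs)) :=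
    ((TensorRestrictsTo.refl U).directSum hs).kronecker ((TensorRestrictsTo.refl U).directSum hs)
  have hmid : TensorRestrictsTo
      (directSumTensor (kroneckerTensor P SLt) (kroneckerTensor SLt P))
      (kroneckerTensor (unitTensor K 2) (kroneckerTensor P Mt)) :=
    (((TensorRestrictsTo.refl _).directSum (tensorRestrictsTo_kronecker_swap P SLt)).trans
      (tensorRestrictsTo_directSum_self_unit_two _)).trans
      ((TensorRestrictsTo.refl _).kronecker ((TensorRestrictsTo.refl P).kronecker ht))
  have htgt : TensorRestrictsTo
      (directSumTensor (directSumTensor (kroneckerTensor P P)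
        (directSumTensor (kroneckerTensor P SLt) (kroneckerTensor SLt P))) SLt')
      (directSumTensor P₂ (directSumTensor
        (kroneckerTensor (unitTensor K 2) (kroneckerTensor P Mt)) Mt')) :=
    (tensorRestrictsTo_directSum_assoc _ _ _).trans (hP.directSum (hmid.directSum ht'))
  exact (hsrc.algDegeneratesTo_trans hcore).trans_restrictsTo htgt

end Assemble

/-! ## The discharge -/

/-- **Alman–Li 2026, §7.1 (Thm. 6.2 applied to Prop. 7.1)** — discharge of the tree's named fact
`AlmanLi2026_iteratedSpeedup_cw` (all three directions, over `ℂ`). [cite: AlmanLi2026, §7.1] -/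
theorem _root_.Literature.Computability.AlgebraicComplexity.AlmanLi2026_iteratedSpeedup_cw_holds :
    AlmanLi2026_iteratedSpeedup_cw := by
  intro q n t hq hn hlt ht
  obtain rfl : t = (q + 2) ^ n + q ^ n - 2 * (q + 1) ^ n := by omega
  classical
  -- the core degeneration over `ℂ`, corner-deleted square expanded
  have hK := thm62_cw ℂ q n (by omega)
  rw [squareMinusCorner_eq_directSum] at hK
  have hP := tensorRestrictsTo_kroneckerPow_two_mul (cwTensor ℂ q) n
  -- direction `⟨·,1,1⟩` (slices with trivial factor third, as produced)
  have h₃ := assemble_direction hK (tensorRestrictsTo_matMul_rotate₁ (q ^ n)) hP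
    (tensorRestrictsTo_rotate₁_matMul _) (tensorRestrictsTo_rotate₁_matMul _)
  -- direction `⟨1,1,·⟩`: rotate once
  have hK₂ := algDegeneratesTo_rotate_modes hK
  simp only [rotate_kronecker₂, rotate_directSum₂, rotate_unit₂, rotate_kroneckerPow₂,
    rotate_cwTensor] at hK₂
  have h₂ := assemble_direction hK₂ (tensorRestrictsTo_matMul_rotate₂ (q ^ n)) hP
    (tensorRestrictsTo_rotate₂_matMul _) (tensorRestrictsTo_rotate₂_matMul _)
  -- direction `⟨1,·,1⟩`: rotate twice
  have hK₁ := algDegeneratesTo_rotate_modes (algDegeneratesTo_rotate_modes hK)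
  simp only [rotate_kronecker₂, rotate_directSum₂, rotate_unit₂, rotate_kroneckerPow₂,
    rotate_cwTensor, rotate_rotate_rotate₂] at hK₁
  have h₁ := assemble_direction hK₁
    (tensorRestrictsTo_matMulTensor_oneSliceTensor (Function.Embedding.refl (Fin (q ^ n)))) hP
    (tensorRestrictsTo_oneSliceTensor_matMulTensor (Equiv.refl _))
    (tensorRestrictsTo_oneSliceTensor_matMulTensor (Equiv.refl _))
  exact ⟨h₁, h₂, h₃⟩

/-- **Alman–Li 2026, Theorem 1.3** — discharge of the tree's named fact
`AlmanLi2026_asymptoticRank_cwTwo_lt` (`R̃(T_{cw,2}) < 3.931`, `AlmanLi2026SmallCW.lean`): the §7.1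
display just proved, Strassen calculus in certificate form (`AlmanLi2026IteratedSpectrumBound`) and
the kernel certificate for Table 1's `γ'_2` (`AlmanLi2026GammaPrimeCertificate`), assembled in
`AlmanLi2026CwTwoBound`. [cite: AlmanLi2026, Thm 1.3] -/
theorem _root_.Literature.Computability.AlgebraicComplexity.AlmanLi2026_asymptoticRank_cwTwo_lt_holds :
    AlmanLi2026_asymptoticRank_cwTwo_lt :=
  AlmanLi2026.asymptoticRank_cwTwo_lt_of_iterated AlmanLi2026_iteratedSpeedup_cw_holds

end AlmanLi2026

end Literature.Computability.AlgebraicComplexity
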